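import Literature.NumberTheory.EllipticCurves.PAdicLFunction
import Literature.NumberTheory.EllipticCurves.Isogeny
import Literature.NumberTheory.EllipticCurves.SerreOpenImageFinalProofs
import Literature.NumberTheory.EllipticCurves.TorsionFrobeniusChebotarevProofs
import Literature.NumberTheory.EllipticCurves.SupersingularDensitySerreTraceProofs
import Literature.NumberTheory.EllipticCurves.SupersingularDensitySerreFrobeniusProofs
import Literature.NumberTheory.EllipticCurves.SwanConductorTorsionProofs
import Literature.NumberTheory.EllipticCurves.ComplexMultiplicationCoatesWilesSahProofs
import Literature.NumberTheory.EllipticCurves.OrdinaryPrimesProofs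
import Literature.NumberTheory.GaloisRepresentations.DirichletCharacterOfGaloisCharacter
import HarnessLib

/-!
# BirchSwinnertonDyer / LeadingTerm — crux `TamePinchR` (stmt-BirchSwinnertonDyer-17007), line `Sketch`,
# stub A: admissible, ordinary, non-anomalous prime supply for non-CM curves

For a NON-CM elliptic curve `E/ℚ` (globally minimal `W`) and any finite set `S` of primes there is
a prime `p ∉ S`, `p ≥ 5`, of good ORDINARY reduction (`p ∤ a_p`), NON-ANOMALOUS (`p ∤ a_p - 1`,
i.e. `E(ℚ_p)[p] = 0`), with SURJECTIVE mod-`p` Galois representation. Ingredients, all theorems of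
the tree:

* Serre's open image theorem (`serre_open_image_holds`): `ρ̄_{E,p}` is onto for `p ≥ p₀(E)`;
* Chebotarev for the division field `ℚ(E[3])` (`chebotarev_geomTorsion_holds` at `σ = 1`): outside
  any finite set there is a prime `p` with an arithmetic Frobenius acting TRIVIALLY on `E[3]`;
* `Tr ρ̄_{E,3}(Frob_p) ≡ a_p (mod 3)` (`trace_galoisRepTorsion_frobenius_eq`, Serre 1981 (238)) and
  `dim_{𝔽₃} E[3] = 2` (`finrank_geomTorsion_eq_two`), so `a_p ≡ 2 (mod 3)`, whence `a_p ∉ {0, 1}`;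
* for `p ≥ 7` of good reduction, `p ∣ a_p ⇔ a_p = 0` and `p ∣ a_p - 1 ⇔ a_p = 1` (Hasse;
  `natCast_dvd_frobeniusTrace_iff_eq_zero`, `CoatesWiles1977.frobeniusTrace_modEq_one_iff`);
* good reduction off the prime divisors of the minimal discriminant
  (`hasGoodReductionAtPrime_of_not_dvd`).
-/

set_option linter.dupNamespace false

noncomputable section

namespace Summit.BirchSwinnertonDyer.BirchSwinnertonDyer.Theorems

open scoped MatrixGroups ModularForm Classical
open CongruenceSubgroup Literature.NumberTheory.EllipticCurves
  Literature.NumberTheory.EllipticCurves.ModularForms WeierstrassCurve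
open NumberField IsDedekindDomain Rat.HeightOneSpectrum Literature.NumberTheory.GaloisRepresentations

/-- **`a_p ≡ 2 (mod ℓ)` at a prime splitting completely in `ℚ(E[ℓ])`.** If `p ≠ ℓ` is a prime of
good reduction of the globally minimal elliptic `W/ℚ` and some arithmetic Frobenius `φ` above `p`
acts trivially on `E[ℓ]`, then `a_p ≡ Tr ρ̄_{E,ℓ}(φ) = Tr(id_{E[ℓ]}) = dim E[ℓ] = 2 (mod ℓ)`
(Serre 1981, (238); Silverman AEC III.6.4(b)). [cite: Serre1981, §8.1 eq. (238) (p. 188)] -/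
theorem stubA_frobeniusTrace_cast_eq_two (W : WeierstrassCurve ℚ) [W.IsElliptic]
    [W.IsGloballyMinimal] (ℓ : ℕ) [Fact ℓ.Prime] {p : ℕ} [Fact p.Prime] (hpℓ : p ≠ ℓ)
    (hgood : W.HasGoodReductionAtPrime p) {v : HeightOneSpectrum (𝓞 ℚ)}
    (hv : (primesEquiv v : ℕ) = p) {𝔓 : Ideal (absIntegers (𝓞 ℚ) ℚ)} (h𝔓 : 𝔓 ∈ v.primesAbove)
    {φ : Field.absoluteGaloisGroup ℚ} (hφ : IsArithFrobAt (𝓞 ℚ) φ 𝔓)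
    (hfix : ∀ P : W.geomTorsion ℓ, φ • P = P) :
    (W.frobeniusTrace p : ZMod ℓ) = 2 := by
  letI : Module (ZMod ℓ) (geomTorsion W ℓ) := AddSubgroup.torsionBy.zmodModule
  have htr := W.trace_galoisRepTorsion_frobenius_eq ℓ hpℓ hgood hv h𝔓 hφ
  have hid : ((galoisRepTorsion W ℓ φ).toAdd.toAddMonoidHom.toZModLinearMap ℓ) =
      (LinearMap.id : W.geomTorsion ℓ →ₗ[ZMod ℓ] W.geomTorsion ℓ) := by
    apply LinearMap.ext
    intro P
    change (galoisRepTorsion W ℓ φ).toAdd P = P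
    rw [galoisRepTorsion_apply]
    exact hfix P
  have hℓ0 : (ℓ : ℚ) ≠ 0 := Nat.cast_ne_zero.mpr (Fact.out : ℓ.Prime).ne_zero
  haveI : Finite (W.geomTorsion ℓ) := W.finite_geomTorsion_nat (Fact.out : ℓ.Prime).ne_zero
  haveI : Module.Finite (ZMod ℓ) (W.geomTorsion ℓ) := Module.Finite.of_finite
  rw [hid, LinearMap.trace_id, W.finrank_geomTorsion_eq_two ℓ hℓ0] at htr
  exact_mod_cast htr.symm

/-- Stub **A** (admissible non-anomalous prime supply). A non-CM elliptic `E/ℚ` has, outside any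
finite set of primes, a prime `p ≥ 5` of good ordinary reduction, with `a_p ≢ 1 (mod p)` and with
surjective mod-`p` Galois representation: `ρ̄_{E,p}` is onto for all `p ≥ p₀` (Serre 1972, §4.2
Thm. 2; tree theorem `serre_open_image_holds`), good reduction holds off the finitely many primes of
bad reduction, and infinitely many primes have `a_p ∉ {0, 1}` (the supersingular and the anomalous
primes both have density zero for non-CM `E`, Serre 1981 §8; or Chebotarev in `ℚ(E[ℓ])/ℚ`).
[cite: Serre1972, §4.2 Théorème 2] -/
theorem stub_admissibleSupply :
    ∀ (W : WeierstrassCurve ℚ) [W.IsElliptic] [W.IsGloballyMinimal], ¬ W.HasCM →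
      ∀ S : Finset ℕ, ∃ p ∉ S, ∃ _ : Fact p.Prime, 5 ≤ p ∧ IsOrdinaryAt W p ∧
        W.HasSurjectiveModNGaloisRep p ∧ ¬ (p : ℤ) ∣ W.frobeniusTrace p - 1 := by
  intro W _ _ hCM S
  obtain ⟨p₀, hp₀⟩ := serre_open_image_holds W hCM
  have hΔ0 : minimalDiscriminantInt W ≠ 0 := minimalDiscriminantInt_ne_zero W
  -- the finite exceptional set
  set T : Set ℕ := ((↑S ∪ Set.Iio (max p₀ 7)) ∪ {q | q ∣ (minimalDiscriminantInt W).natAbs})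
    with hT_def
  have hT : T.Finite :=
    (S.finite_toSet.union (Set.finite_Iio _)).union
      ((Nat.divisors _).finite_toSet.subset fun q hq ↦
        Nat.mem_divisors.mpr ⟨hq, Int.natAbs_ne_zero.mpr hΔ0⟩)
  obtain ⟨p, v, 𝔓, φ, hp, hpT, hv, h𝔓, hφ, hfix⟩ :=
    chebotarev_geomTorsion_holds W ((3 : ℕ) : ℤ) (by norm_num) T hT 1
  simp only [hT_def, Set.mem_union, Finset.mem_coe, Set.mem_Iio, Set.mem_setOf_eq, not_or,
    not_lt] at hpT
  obtain ⟨⟨hpS, hp7⟩, hpΔ⟩ := hpT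
  have hp7' : 7 ≤ p := le_of_max_le_right hp7
  have hpp₀ : p₀ ≤ p := le_of_max_le_left hp7
  haveI : Fact p.Prime := ⟨hp⟩
  have hpΔ' : ¬ (p : ℤ) ∣ minimalDiscriminantInt W := fun h ↦ hpΔ (Int.natCast_dvd.mp h)
  have hgood : W.HasGoodReductionAtPrime p := hasGoodReductionAtPrime_of_not_dvd W p hpΔ'
  have hp3 : p ≠ 3 := by omega
  have hv' : (primesEquiv v : ℕ) = p := natGenerator_eq_of_natCast_mem_asIdeal hp hv
  have hfix' : ∀ P : W.geomTorsion ((3 : ℕ) : ℤ), φ • P = P := fun P ↦ by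
    rw [hfix P, one_smul]
  have h2 := stubA_frobeniusTrace_cast_eq_two W 3 hp3 hgood hv' h𝔓 hφ hfix'
  have ha0 : W.frobeniusTrace p ≠ 0 := fun h ↦ by
    rw [h, Int.cast_zero] at h2
    exact absurd h2 (by decide)
  have ha1 : W.frobeniusTrace p ≠ 1 := fun h ↦ by
    rw [h, Int.cast_one] at h2
    exact absurd h2 (by decide)
  refine ⟨p, hpS, ⟨hp⟩, by omega, ⟨hgood, ?_⟩, ?_, ?_⟩
  · rwa [natCast_dvd_frobeniusTrace_iff_eq_zero W p (by omega) hgood]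
  · exact_mod_cast hp₀ p hp hpp₀
  · intro hdvd
    apply ha1
    refine (CoatesWiles1977.frobeniusTrace_modEq_one_iff W hp (by omega) hpΔ').mp ?_
    exact (Int.modEq_iff_dvd.mpr hdvd).symm

end Summit.BirchSwinnertonDyer.BirchSwinnertonDyer.Theorems

end
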